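import Summits.PneNP.PneNP.Theorems.ConvexRankGatesLinAlgGateBlindChainCover

/-!
# Route ConvexRankGates, crux `LinAlgGateBlind` (stmt-PneNP-10681): the chain cover by GROUP ORDER

Support lemma for the research stub `stub_sgPerm` (line `dnf-invariant-wide-gates-see-small-cliques`; vocabulary of
`Theorems/ConvexRankGatesLinAlgGateBlindDefs.lean`), companion of
`Theorems/ConvexRankGatesLinAlgGateBlindChainCover.lean`. The chain cover there only uses that the live closure of a
rejected graph sits in a group of order `≤ d'!`. For the class of permutation term gates whose permutations generate a
group `G₀ = ⟨σ_a : a⟩` of order `≤ M` — on ANY number of points — the same argument covers the rejection region by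
`≤ #𝒱(l)^{⌊log₂ M⌋}` all-off events, so the PERM door of the line is blind to every gate whose group has order
`≤ 2^{m^{11/16}/(8 log₂ m)}`, however many points it moves:

* `sgAt_permOrder_of_chain_budget` — finite form (positive budget + fragility budget `#𝒱(l)^{⌊log₂ M⌋}·(1/2)^{ν+1}·#𝒱(l) < ε`);
* `sgAt_permOrder_of_logb_le_rpow` — at the parameters of the line, closed form `log₂ M ≤ m^{11/16}/(8 log₂ m)`;
* `isPermGate_permOrder` — `PERM_d` gates have group order `≤ d!`, so the group-order form contains the dimension form.

The class is written inline (no new definition):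
`fun g => ∃ d σ τ, Nat.card ⟨range σ⟩ ≤ M ∧ ∀ v, g.2 v ↔ τ ∈ ⟨σ '' {i | v i}⟩`. [folklore]
-/

-- `Summit.PneNP.PneNP.…` duplicates `PneNP` BY DESIGN (single-problem summit).
set_option linter.dupNamespace false

namespace Summit.PneNP.PneNP.Theorems

open Finset Filter Literature.Computability.Complexity Razborov
open Summit.PneNP.PneNP.Cruxes.LinAlgGateBlind.DnfInvariantWideGatesSeeSmallCliques

/-! ### SG for permutation gates of bounded group order -/

/-- **SG from the chain-cover budget, group-order form (finite form).** Let `q ∈ [0,1]`, `1 - q^{C(l,2)} ≤ 1/2`,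
`0 < ε`, `2t ≤ l`, the positive budget `(ν·C(l,2))^t · C(m-t, k-t) ≤ ε·C(m,k)` and the fragility budget
`#𝒱(l)^{⌊log₂ M⌋} · (1/2)^{ν+1} · #𝒱(l) < ε`. Then `SGAt` holds for the class of permutation term gates whose
permutations generate a group of order `≤ M` (on any number of points): the live closure `H ≤ G₀ = ⟨σ_a : a⟩` of a
rejected graph is generated by the permutations of `≤ log₂ |G₀| ≤ ⌊log₂ M⌋` live atoms (`exists_subset_closure_eq`,
Lagrange doubling inside `G₀`), whence `≤ #𝒱(l)^{⌊log₂ M⌋}` all-off cover events, and `sg_of_maxtermCover` concludes.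
[folklore] -/
theorem sgAt_permOrder_of_chain_budget : ∀ (m l k M ν t : ℕ) (q ε : ℝ), 0 ≤ q → q ≤ 1 →
    1 - q ^ (l.choose 2) ≤ 1 / 2 → 0 < ε → 2 * t ≤ l →
    (((ν * l.choose 2) ^ t * (m - t).choose (k - t) : ℕ) : ℝ) ≤ ε * (m.choose k : ℝ) →
    (#(smallSets (Fin m) l) : ℝ) ^ (Nat.log 2 M) * (1 / 2) ^ (ν + 1) * #(smallSets (Fin m) l) < ε →
    SGAt m (fun g => ∃ (d : ℕ) (σ : Fin g.1 → Equiv.Perm (Fin d)) (τ : Equiv.Perm (Fin d)),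
        Nat.card (Subgroup.closure (Set.range σ)) ≤ M ∧
          ∀ v, g.2 v = true ↔ τ ∈ Subgroup.closure (σ '' {i | v i = true})) l k q ε := by
  intro m l k M ν t q ε hq0 hq1 hql hε htl hpos hfrag O hO
  classical
  obtain ⟨g, ⟨d', σ, τ, hM, hg⟩, X, hX, hOX⟩ := hO
  set V := smallSets (Fin m) l with hVdef
  have hV : (0 : ℝ) < #V := Nat.cast_pos.2 (card_pos.2 ⟨∅, empty_mem_smallSets l⟩)
  set G₀ : Subgroup (Equiv.Perm (Fin d')) := Subgroup.closure (Set.range σ) with hG₀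
  set L := Nat.log 2 (Nat.card G₀) with hLdef
  have hLle : L ≤ Nat.log 2 M := Nat.log_mono_right hM
  -- the subgroup generated by the permutations of the atoms listed by `f`
  set K : (Fin L → V) → Subgroup (Equiv.Perm (Fin d')) :=
    fun f => Subgroup.closure (σ '' {a | ∃ i, ((f i : V) : Finset (Fin m)) = X a}) with hKdef
  set live : (KEdge m → Bool) → Fin g.1 → Prop := fun x a => CliquePresent (X a) x with hlive
  have hclosure_eq : ∀ x, Subgroup.closure (σ '' {i | (fun a => atomB (X a) x) i = true}) =
      Subgroup.closure (σ '' {a | live x a}) := by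
    intro x
    have : {i | (fun a => atomB (X a) x) i = true} = {a | live x a} := by
      ext a
      simp [atomB, hlive]
    rw [this]
  -- the chain cover: `O x = 0` iff some `K_f ∌ τ` contains every live generator
  have hiff : ∀ x, O x = false ↔ ∃ f : Fin L → V, τ ∉ K f ∧ ∀ a, σ a ∉ K f → ¬ live x a := by
    intro x
    rw [hOX x]
    constructor
    · intro h0
      have hτ : τ ∉ Subgroup.closure (σ '' {a | live x a}) := fun hτ => by
        rw [← hclosure_eq x] at hτ
        rw [(hg _).2 hτ] at h0
        exact Bool.noConfusion h0
      -- few live atoms generate the live closure (doubling inside `G₀`)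
      obtain ⟨J, hJI, hJpow, hJ⟩ := exists_subset_closure_eq σ (univ.filter fun a => live x a)
      have hJG₀ : Subgroup.closure (σ '' (J : Set (Fin g.1))) ≤ G₀ :=
        Subgroup.closure_mono (by rintro _ ⟨a, -, rfl⟩; exact ⟨a, rfl⟩)
      have hJcard : #J ≤ L :=
        Nat.le_log_of_pow_le one_lt_two (hJpow.trans (Subgroup.card_le_of_le hJG₀))
      have hIset : ((univ.filter fun a => live x a : Finset (Fin g.1)) : Set (Fin g.1)) = {a | live x a} := by
        ext a
        simp
      rw [hIset] at hJ
      set 𝒥 : Finset (Finset (Fin m)) := J.image X with h𝒥def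
      have h𝒥V : 𝒥 ⊆ V := by
        intro Y hY
        obtain ⟨a, -, rfl⟩ := mem_image.1 hY
        exact hX a
      have h𝒥card : #𝒥 ≤ L := card_image_le.trans hJcard
      set e𝒥 := 𝒥.equivFin with he𝒥
      set f : Fin L → V := fun i =>
        if h : (i : ℕ) < #𝒥 then ⟨(e𝒥.symm ⟨i, h⟩ : Finset (Fin m)), h𝒥V (e𝒥.symm ⟨i, h⟩).2⟩
        else ⟨∅, empty_mem_smallSets l⟩ with hfdef
      have hf_live : ∀ a, (∃ i, ((f i : V) : Finset (Fin m)) = X a) → live x a := by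
        rintro a ⟨i, hi⟩
        by_cases h : (i : ℕ) < #𝒥
        · have hmem : X a ∈ 𝒥 := by
            rw [← hi, hfdef]
            simp only [h, dif_pos]
            exact (e𝒥.symm ⟨i, h⟩).2
          obtain ⟨b, hb, hba⟩ := mem_image.1 hmem
          have hb_live : live x b := (mem_filter.1 (hJI hb)).2
          show CliquePresent (X a) x
          rw [← hba]
          exact hb_live
        · have hempty : X a = ∅ := by
            rw [← hi, hfdef]
            simp only [h, dif_neg, not_false_eq_true]
          show CliquePresent (X a) x
          rw [hempty]
          exact cliquePresent_empty x
      have hJ_listed : ∀ b ∈ J, ∃ i, ((f i : V) : Finset (Fin m)) = X b := by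
        intro b hb
        have hXb : X b ∈ 𝒥 := mem_image_of_mem X hb
        refine ⟨⟨e𝒥 ⟨X b, hXb⟩, lt_of_lt_of_le (e𝒥 ⟨X b, hXb⟩).2 h𝒥card⟩, ?_⟩
        rw [hfdef]
        simp only [(e𝒥 ⟨X b, hXb⟩).2, dif_pos, Fin.eta, Equiv.symm_apply_apply]
      have hKf : K f = Subgroup.closure (σ '' {a | live x a}) := by
        apply le_antisymm
        · refine (Subgroup.closure_le _).2 ?_
          rintro _ ⟨a, ha, rfl⟩
          exact Subgroup.subset_closure ⟨a, hf_live a ha, rfl⟩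
        · rw [← hJ]
          exact Subgroup.closure_mono (Set.image_mono fun b hb => hJ_listed b hb)
      refine ⟨f, by rwa [hKf], fun a ha hla => ha ?_⟩
      rw [hKf]
      exact Subgroup.subset_closure ⟨a, hla, rfl⟩
    · rintro ⟨f, hτ, hf⟩
      rcases hv : g.2 (fun a => atomB (X a) x) with _ | _
      · rfl
      · exfalso
        have hmem := (hg _).1 hv
        rw [hclosure_eq x] at hmem
        refine hτ ((Subgroup.closure_le (K f)).2 ?_ hmem)
        rintro _ ⟨a, ha, rfl⟩
        by_contra hK
        exact hf a hK ha
  -- index the chain cover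
  set J := {f : Fin L → V // τ ∉ K f} with hJ
  set N := Nat.card J with hNdef
  set e : J ≃ Fin N := Finite.equivFin J with he
  set 𝓛 : Fin N → Finset (Finset (Fin m)) :=
    fun j => (univ.filter fun a => σ a ∉ K (e.symm j).1).image X with h𝓛
  have hNle : (N : ℝ) ≤ (#V : ℝ) ^ (Nat.log 2 M) := by
    have h1 : N ≤ Nat.card (Fin L → V) :=
      Nat.card_le_card_of_injective (Subtype.val : J → (Fin L → V)) Subtype.val_injective
    have h2 : Nat.card (Fin L → V) = #V ^ L := by
      rw [Nat.card_eq_fintype_card, Fintype.card_fun, Fintype.card_fin, Fintype.card_coe]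
    rw [h2] at h1
    have h3 : #V ^ L ≤ #V ^ Nat.log 2 M :=
      Nat.pow_le_pow_right (card_pos.2 ⟨∅, empty_mem_smallSets l⟩) hLle
    exact_mod_cast h1.trans h3
  have hN : (N : ℝ) * (1 / 2) ^ (ν + 1) < ε / #V := by
    rw [lt_div_iff₀ hV]
    calc (N : ℝ) * (1 / 2) ^ (ν + 1) * #V
        ≤ (#V : ℝ) ^ (Nat.log 2 M) * (1 / 2) ^ (ν + 1) * #V := by gcongr
      _ < ε := hfrag
  have h1 : ∀ j, 𝓛 j ⊆ V := by
    intro j Y hY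
    obtain ⟨a, -, rfl⟩ := mem_image.1 hY
    exact hX a
  have h2 : ∀ x, O x = false → ∃ j, ∀ Y ∈ 𝓛 j, ¬ CliquePresent Y x := by
    intro x hx
    obtain ⟨f, hτ, hf⟩ := (hiff x).1 hx
    refine ⟨e ⟨f, hτ⟩, fun Y hY => ?_⟩
    obtain ⟨a, ha, rfl⟩ := mem_image.1 hY
    rw [mem_filter, Equiv.symm_apply_apply] at ha
    exact hf a ha.2
  have h3 : ∀ j x, (∀ Y ∈ 𝓛 j, ¬ CliquePresent Y x) → O x = false := fun j x hall =>
    (hiff x).2 ⟨(e.symm j).1, (e.symm j).2, fun a ha =>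
      hall (X a) (mem_image_of_mem X (mem_filter.2 ⟨mem_univ a, ha⟩))⟩
  obtain ⟨𝒜, h𝒜, hP, hNg⟩ := sg_of_maxtermCover m l k N ν t q (ε / #V) O 𝓛 h1 h2 h3
    hq0 hq1 hql (div_pos hε hV) hN htl
  refine ⟨𝒜, h𝒜, ?_, hNg.trans_eq (mul_div_cancel₀ ε hV.ne')⟩
  calc (#(lostPos m k O 𝒜) : ℝ) ≤ (((ν * l.choose 2) ^ t * (m - t).choose (k - t) : ℕ) : ℝ) := by
        exact_mod_cast hP
    _ ≤ ε * (m.choose k : ℝ) := hpos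

open DenseRegime in
/-- **The PERM door is blind to every permutation gate whose group has order `≤ 2^{m^{11/16}/(8 log₂ m)}`**, on any
number of points, at every level `c`, eventually in `m`: `SGAt` for the class of permutation term gates with
`log₂ |⟨σ_a : a⟩| ≤ m^{11/16}/(8 log₂ m)`. Proof: `sgAt_permOrder_of_chain_budget` at `ν = ⌈m^{3/4}⌉₊`, `t = ⌊lOf m/2⌋`
with `stub_denseRegime`, `permSmallDim_budgets`, `⌊log₂ M⌋ · log₂ #𝒱(l) ≤ log₂ M · lOf m · log₂(m+1) ≤ m^{3/4}/2`
(`logb_card_smallSets_le`, `lOf m ≤ m^{1/16} + 1`, `log₂(m+1) ≤ log₂ m + 1`). [folklore] -/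
theorem sgAt_permOrder_of_logb_le_rpow : ∀ c : ℕ, ∀ᶠ m : ℕ in atTop, ∀ M : ℕ,
    Real.logb 2 M ≤ (m : ℝ) ^ (11 / 16 : ℝ) / (8 * Real.logb 2 m) →
    SGAt m (fun g => ∃ (d : ℕ) (σ : Fin g.1 → Equiv.Perm (Fin d)) (τ : Equiv.Perm (Fin d)),
        Nat.card (Subgroup.closure (Set.range σ)) ≤ M ∧
          ∀ v, g.2 v = true ↔ τ ∈ Subgroup.closure (σ '' {i | v i = true}))
      (lOf m) (kOf m) (qOf m) (epsOf c m) := by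
  intro c
  filter_upwards [stub_denseRegime c, permSmallDim_budgets c, eventually_ge_atTop 2] with m hD hB hm2 M hM
  obtain ⟨-, -, -, hq0, hq1, -, -, -, -, hhalf⟩ := hD
  obtain ⟨hpos, hfrag⟩ := hB
  have hm1 : 1 ≤ m := le_trans (by norm_num) hm2
  have hmR : (2 : ℝ) ≤ m := by exact_mod_cast hm2
  have hmpos : (0 : ℝ) < m := by linarith
  have hε : 0 < epsOf c m := by
    rw [epsOf_eq]
    positivity
  have hV : (0 : ℝ) < #(smallSets (Fin m) (lOf m)) :=
    Nat.cast_pos.2 (card_pos.2 ⟨∅, empty_mem_smallSets (lOf m)⟩)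
  have hV1 : (1 : ℝ) ≤ #(smallSets (Fin m) (lOf m)) := by
    exact_mod_cast card_pos.2 ⟨∅, empty_mem_smallSets (lOf m)⟩
  have hlogV0 : 0 ≤ Real.logb 2 (#(smallSets (Fin m) (lOf m)) : ℝ) := Real.logb_nonneg one_lt_two hV1
  -- `⌊log₂ M⌋ ≤ log₂ M` (and `0 ≤ ⌊log₂ M⌋`)
  have hLM : (Nat.log 2 M : ℝ) ≤ max (Real.logb 2 M) 0 := by
    rcases Nat.eq_zero_or_pos M with rfl | hMpos
    · simp
    · have := Real.natLog_le_logb M 2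
      push_cast at this
      exact this.trans (le_max_left _ _)
  -- `lOf m · log₂(m+1) ≤ 4 m^{1/16} log₂ m`
  have hx1 : (1 : ℝ) ≤ (m : ℝ) ^ (1 / 16 : ℝ) := one_le_rpow_sixteenth hm1
  have hL1 : 1 ≤ Real.logb 2 m := by
    rw [← Real.logb_self_eq_one one_lt_two]
    exact Real.logb_le_logb_of_le one_lt_two two_pos hmR
  have hlOf : (lOf m : ℝ) ≤ (m : ℝ) ^ (1 / 16 : ℝ) + 1 := lOf_le_rpow_add_one m
  have hlog : Real.logb 2 ((m : ℝ) + 1) ≤ Real.logb 2 m + 1 :=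
    calc Real.logb 2 ((m : ℝ) + 1) ≤ Real.logb 2 (2 * m) :=
          Real.logb_le_logb_of_le one_lt_two (by positivity) (by linarith)
      _ = Real.logb 2 2 + Real.logb 2 m := Real.logb_mul (by norm_num) hmpos.ne'
      _ = Real.logb 2 m + 1 := by rw [Real.logb_self_eq_one one_lt_two, add_comm]
  have hlog0 : 0 ≤ Real.logb 2 ((m : ℝ) + 1) := Real.logb_nonneg one_lt_two (by linarith)
  have hfac : (lOf m : ℝ) * Real.logb 2 ((m : ℝ) + 1) ≤ 4 * (m : ℝ) ^ (1 / 16 : ℝ) * Real.logb 2 m :=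
    calc (lOf m : ℝ) * Real.logb 2 ((m : ℝ) + 1) ≤ ((m : ℝ) ^ (1 / 16 : ℝ) + 1) * (Real.logb 2 m + 1) :=
          mul_le_mul hlOf hlog hlog0 (by positivity)
      _ ≤ (2 * (m : ℝ) ^ (1 / 16 : ℝ)) * (2 * Real.logb 2 m) :=
          mul_le_mul (by linarith) (by linarith) (by linarith) (by linarith)
      _ = 4 * (m : ℝ) ^ (1 / 16 : ℝ) * Real.logb 2 m := by ring
  have h34 : (m : ℝ) ^ (11 / 16 : ℝ) * (m : ℝ) ^ (1 / 16 : ℝ) = (m : ℝ) ^ (3 / 4 : ℝ) := by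
    rw [← Real.rpow_add hmpos]
    norm_num
  have hmax : max (Real.logb 2 M) 0 ≤ (m : ℝ) ^ (11 / 16 : ℝ) / (8 * Real.logb 2 m) :=
    max_le hM (div_nonneg (by positivity) (by positivity))
  -- the exponent budget `⌊log₂ M⌋ · log₂ #𝒱 ≤ m^{3/4}/2`
  have hexp : (Nat.log 2 M : ℝ) * Real.logb 2 (#(smallSets (Fin m) (lOf m)) : ℝ) ≤ (m : ℝ) ^ (3 / 4 : ℝ) / 2 :=
    calc (Nat.log 2 M : ℝ) * Real.logb 2 (#(smallSets (Fin m) (lOf m)) : ℝ)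
        ≤ max (Real.logb 2 M) 0 * ((lOf m : ℝ) * Real.logb 2 ((m : ℝ) + 1)) :=
          mul_le_mul hLM (logb_card_smallSets_le m (lOf m)) hlogV0 (le_max_right _ _)
      _ ≤ (m : ℝ) ^ (11 / 16 : ℝ) / (8 * Real.logb 2 m) * (4 * (m : ℝ) ^ (1 / 16 : ℝ) * Real.logb 2 m) :=
          mul_le_mul hmax hfac (mul_nonneg (Nat.cast_nonneg _) hlog0) (div_nonneg (by positivity) (by positivity))
      _ = (m : ℝ) ^ (11 / 16 : ℝ) * (m : ℝ) ^ (1 / 16 : ℝ) / 2 := by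
          field_simp
          ring
      _ = (m : ℝ) ^ (3 / 4 : ℝ) / 2 := by rw [h34]
  have hcard : (#(smallSets (Fin m) (lOf m)) : ℝ) ^ (Nat.log 2 M) ≤ (2 : ℝ) ^ ((m : ℝ) ^ (3 / 4 : ℝ) / 2) := by
    have : (#(smallSets (Fin m) (lOf m)) : ℝ) ^ (Nat.log 2 M) =
        (2 : ℝ) ^ ((Nat.log 2 M : ℝ) * Real.logb 2 (#(smallSets (Fin m) (lOf m)) : ℝ)) := by
      rw [mul_comm, Real.rpow_mul (by norm_num : (0 : ℝ) ≤ 2), Real.rpow_logb two_pos (by norm_num) hV,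
        Real.rpow_natCast]
    rw [this]
    exact Real.rpow_le_rpow_of_exponent_le one_le_two hexp
  refine sgAt_permOrder_of_chain_budget m (lOf m) (kOf m) M ⌈(m : ℝ) ^ (3 / 4 : ℝ)⌉₊ (lOf m / 2)
    (qOf m) (epsOf c m) hq0 hq1 (by linarith) hε (Nat.mul_div_le (lOf m) 2) hpos ?_
  calc (#(smallSets (Fin m) (lOf m)) : ℝ) ^ (Nat.log 2 M) * (1 / 2) ^ (⌈(m : ℝ) ^ (3 / 4 : ℝ)⌉₊ + 1) *
        #(smallSets (Fin m) (lOf m))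
      ≤ (2 : ℝ) ^ ((m : ℝ) ^ (3 / 4 : ℝ) / 2) * (1 / 2) ^ (⌈(m : ℝ) ^ (3 / 4 : ℝ)⌉₊ + 1) *
        #(smallSets (Fin m) (lOf m)) := by gcongr
    _ < epsOf c m := hfrag

/-- Every `PERM_d` gate is a permutation gate of group order `≤ d!` (`|⟨σ_a : a⟩| ≤ |Sym d'| = d'! ≤ d!`), so the
group-order form contains the dimension form. [folklore] -/
theorem isPermGate_permOrder {d : ℕ} {g : GateFn} (hg : IsPermGate d g) :
    ∃ (d' : ℕ) (σ : Fin g.1 → Equiv.Perm (Fin d')) (τ : Equiv.Perm (Fin d')),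
      Nat.card (Subgroup.closure (Set.range σ)) ≤ d.factorial ∧
        ∀ v, g.2 v = true ↔ τ ∈ Subgroup.closure (σ '' {i | v i = true}) := by
  obtain ⟨d', hd', σ, τ, h⟩ := hg
  refine ⟨d', σ, τ, ?_, h⟩
  have hcd : Nat.card (Equiv.Perm (Fin d')) = d'.factorial := by
    rw [Nat.card_perm, Nat.card_eq_fintype_card, Fintype.card_fin]
  exact ((Subgroup.card_le_card_group _).trans_eq hcd).trans (Nat.factorial_le hd')

end Summit.PneNP.PneNP.Theorems
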